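import Literature.AlgebraicGeometry.AbelianSchemes.PolarizationSymmetricWitness
import Literature.AlgebraicGeometry.AbelianSchemes.IsLambdaOfAtMulAdd
import Literature.AlgebraicGeometry.AbelianSchemes.FibreHomPointsOfFibrePoints
import Literature.AlgebraicGeometry.AbelianVarieties.HomogeneousLineBundleFieldChange
import Literature.AlgebraicGeometry.AbelianVarieties.StructureSheafSemiHomogeneous
import Literature.AlgebraicGeometry.Modules.CechPicOfLocalRing
import HarnessLib

/-!
# Mumford §8 Thm. 1 at a geometric point FROM «`λ̄` onto», and the symmetric ample witness there

Layer `Literature/AlgebraicGeometry/AbelianSchemes`, namespace `Literature.AlgebraicGeometry.AbelianSchemes.AbelianSchemeOver`.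
THEOREMS ONLY (no definition, no named fact, no instance, no `sorry`).

Setting: an abelian scheme `A/S` with dual pair `D = (Â, 𝒫)` ([MilneAV2008] I §8: `Â` classifies rigidified fibrewise-`Pic⁰`
line bundles), an `S`-morphism `λ : A → Â`, a geometric point `s : Spec Ω → S` (`Ω` algebraically closed), `X := A_s`.

* §1 `RigidifiedLineBundle.fibrewisePicZero_of_isHomogeneous` — a rigidified line bundle over the POINT `T = Spec Ω` whose
  module is homogeneous on `A_s` is fibrewise-`Pic⁰` (its fibre at `Spec φ : Spec Ω′ → Spec Ω` is the base change of the module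
  along `φ`, by `rfl`; homogeneity ASCENDS along field maps from an algebraically closed field, ★ `IsHomogeneous.pullbackFst`);
  **`DualPair.exists_nonempty_pullbackP_iso_of_isHomogeneous`** — hence every homogeneous line bundle `E` on `A_s` IS a
  `𝒫`-slice: `E ≅ 𝒫|_{A_s × {b}}` for some `b ∈ Â_s(Ω)` (rigidity at the point is automatic: `Pic(Spec Ω) = 1`, ★
  `CechPic.eq_one_of_isLocalRing`; then ★ `DualPair.universal`/`classify`).
* §2 **`exists_linEquiv_weilDiv_of_onto`** — **Mumford §8 Theorem 1 at `s` from «`λ̄_s` onto»**: if `λ̄ = Λ(𝒪(Θ))` at `s` and every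
  `Ω`-point of `Â` over `s` is `x ≫ λ` (`hsurj`), then every translation-invariant Cartier divisor `Z` on `A_s` is `∼ D_a(Θ) =
  t_a^*Θ − Θ` for some `a ∈ A_s(Ω)`: `𝒪(Z)` is the slice at some `b` (§1), `b = λ̄(a)`, and the slice at `λ̄(a)` is
  `t_a^*𝒪(Θ) ⊗ 𝒪(Θ)⁻¹ = 𝒪(D_a(Θ))` (★ `IsLambdaOfAt`, ★ `detClass_translateTensorDual_eq_cechClass_weilDiv`).
* §3 **`Polarization.exists_isAmple_isLambdaOfAt_symmetric_of_onto`** — hence, for a polarisation onto on `Ω`-points at `s` and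
  `2` invertible in `Ω`, an ample SYMMETRIC witness `Θ′` (`(−1)^*Θ′ ∼ Θ′`) of `λ̄` exists at `s` (★
  `exists_isAmple_isLambdaOfAt_symmetric_of_forall_exists_linEquiv_weilDiv`).

Purpose (cell `hodgecm-mathlib`, D-0151; Hecke-link socket (B), (X-amp) hand (h1), File 2): with «`λ̄_s` onto» supplied at every
geometric point of the Siegel pieces (B-p02 (g11) (D1)/(D2)/(ISO-pts): `dim Â_s = g` ⇒ isogeny ⇒ onto), (h1) holds at EVERY
geometric point, not only at complex ones.  Count-neutral; HC_CM is proved only modulo the 7 printed citations until rung 0 closes.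

## References
* [MumfordAV1970] D. Mumford, *Abelian Varieties* (1970), §8 Thm. 1 (p. 77), §8 (ii)–(iv) (pp. 74–75).
* [MilneAV2008] J. S. Milne, *Abelian Varieties* (v2.00, 2008), I §8 pp. 36–37.
* [MumfordFogartyKirwan1994] D. Mumford, J. Fogarty, F. Kirwan, *GIT*, 3rd ed. (1994), Ch. 6 §2 Def. 6.2–6.3 (p. 120).
-/

set_option autoImplicit false

noncomputable section

universe u

open CategoryTheory CategoryTheory.Limits AlgebraicGeometry MonoidalCategory
open scoped MonObj

-- `(A.baseChange s).left.Modules` / `(A.fibre s).toAbelianVariety.X.left.Modules` agree by `rfl` only.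
set_option backward.isDefEq.respectTransparency false

namespace Literature.AlgebraicGeometry.AbelianSchemes

open Literature.AlgebraicGeometry.Motives Literature.AlgebraicGeometry.AbelianVarieties Literature.AlgebraicGeometry.Modules

namespace AbelianSchemeOver

variable {S : Scheme.{u}} (A : AbelianSchemeOver S) (D : A.DualPair) {Ω : Type u} [Field Ω] [IsAlgClosed Ω]
  (s : Spec (.of Ω) ⟶ S)

/-! ## §1 Homogeneous line bundles on `A_s` are `𝒫`-slices -/

/-- **A rigidified line bundle over the geometric point `T = Spec Ω` with homogeneous module is fibrewise-`Pic⁰`**: every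
geometric point `t : Spec Ω′ → Spec Ω` is `Spec φ`, the fibre there is the base change of `A_s` along `φ` with module the base
change of `ℒ` (both by `rfl`), and homogeneity ascends along `φ` (★ `IsHomogeneous.pullbackFst`, `Ω` algebraically closed).
[cite: MumfordAV1970, §8 ((ii)–(iv), pp. 74–75)] [cite: MilneAV2008, I §8 pp. 36–37] -/
theorem RigidifiedLineBundle.fibrewisePicZero_of_isHomogeneous (ℒ : A.RigidifiedLineBundle s)
    (h : IsHomogeneous (A.fibre s).toAbelianVariety ℒ.L) : ℒ.FibrewisePicZero := by
  intro Ω' _ _ t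
  obtain ⟨ψ, rfl⟩ := Spec.map_surjective t
  exact IsHomogeneous.pullbackFst ψ.hom (A.fibre s).toAbelianVariety ℒ.hasRank_one h

/-- **Every homogeneous line bundle on `A_s` is a `𝒫`-slice**: for `E` of rank one and homogeneous on `A_s` (`Ω` algebraically
closed) there is `b ∈ Â(Ω)` over `s` with `(1 × b)^*𝒫 ≅ E` — rigidify `E` at the point (`Ȟ¹(Spec Ω, 𝒪^×) = 1`, ★
`CechPic.eq_one_of_isLocalRing`), §1 makes it fibrewise-`Pic⁰`, and the universal property of the dual pair classifies it (★
`DualPair.classify`). [cite: MilneAV2008, I §8 pp. 36–37] [cite: MumfordAV1970, §8 ((ii)–(iv), pp. 74–75)] -/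
theorem DualPair.exists_nonempty_pullbackP_iso_of_isHomogeneous {E : (A.fibre s).toAbelianVariety.X.left.Modules}
    (h₁ : HasRank E 1) (h : IsHomogeneous (A.fibre s).toAbelianVariety E) :
    ∃ (b : Spec (.of Ω) ⟶ D.hat.X.left) (hb : b ≫ D.hat.X.hom = s), Nonempty (D.pullbackP s b hb ≅ E) := by
  -- rigidity along the unit section is automatic over the spectrum of a field
  have hr : Nonempty ((Scheme.Modules.pullback (A.baseChange s).unitSection).obj E ≅ SheafOfModules.unit _) := by
    have hp : HasRank ((Scheme.Modules.pullback (A.baseChange s).unitSection).obj E) 1 := hasRank_pullback _ h₁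
    have hu : HasRank (SheafOfModules.unit (Spec (.of Ω)).ringCatSheaf : (Spec (.of Ω)).Modules) 1 := hasRank_unit_one
    refine (nonempty_iso_iff_detClass_eq hp hu (HasRank.isFiniteLocallyFree' hp) (HasRank.isFiniteLocallyFree' hu)).2 ?_
    rw [CechPic.eq_one_of_isLocalRing (detClass _), CechPic.eq_one_of_isLocalRing (detClass _)]
  let ℒ : A.RigidifiedLineBundle s := { L := E, hasRank_one := h₁, rigid := hr }
  have hℒ : ℒ.FibrewisePicZero := RigidifiedLineBundle.fibrewisePicZero_of_isHomogeneous A s ℒ h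
  exact ⟨D.classify s ℒ hℒ, D.classify_comp_hom s ℒ hℒ, D.nonempty_pullbackP_classify_iso s ℒ hℒ⟩

/-! ## §2 Mumford §8 Theorem 1 at `s` from «`λ̄_s` onto» -/

/-- **MUMFORD §8 THEOREM 1 AT A GEOMETRIC POINT, from «`λ̄` onto on `Ω`-points»**: let `λ̄ = Λ(𝒪(Θ))` at `s` (`Ω` algebraically
closed) and suppose every `Ω`-point of `Â` over `s` is `x ≫ λ` (`hsurj`).  Then every translation-invariant Cartier divisor `Z` on
`A_s` is linearly equivalent to `D_a(Θ) = t_a^*Θ − Θ` for some `a ∈ A_s(Ω)`: `𝒪(Z) ≅ 𝒫|_{A_s × {b}}` (§1), `b = λ̄(a)` (`hsurj` + ★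
partner dictionary), and `𝒫|_{A_s × {λ̄(a)}} ≅ t_a^*𝒪(Θ) ⊗ 𝒪(Θ)⁻¹` has class `[D_a(Θ)]` (★ `IsLambdaOfAt`, ★
`detClass_translateTensorDual_eq_cechClass_weilDiv`). [cite: MumfordAV1970, §8 Thm. 1 (p. 77)] [cite: MilneAV2008, I §8 pp. 36–37] -/
theorem exists_linEquiv_weilDiv_of_onto (lam : A.X ⟶ D.hat.X) {Θ : CartierDivisor (A.fibre s).toAbelianVariety.X.left}
    (hΘ : A.IsLambdaOfAt s D lam Θ) (hsurj : ∀ y : D.hat.FibrePoints s, ∃ x : A.FibrePoints s, x ≫ lam = y)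
    (Z : CartierDivisor (A.fibre s).toAbelianVariety.X.left)
    (hZ : ∀ P : (A.fibre s).toAbelianVariety.Points Ω,
      (Z.pullback ((A.fibre s).toAbelianVariety.translation P).left).LinEquiv Z) :
    ∃ a : (A.fibre s).toAbelianVariety.Points Ω, Z.LinEquiv ((A.fibre s).toAbelianVariety.weilDiv Θ a) := by
  have h₁ : HasRank (lineBundle Z.toUnitCocycle) 1 := Z.toUnitCocycle.hasRank_lineBundle
  have hhom : IsHomogeneous (A.fibre s).toAbelianVariety (lineBundle Z.toUnitCocycle) :=
    (isHomogeneous_lineBundle_iff_forall_linEquiv (A.fibre s).toAbelianVariety Z).2 hZ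
  obtain ⟨b, hb, ⟨i⟩⟩ := DualPair.exists_nonempty_pullbackP_iso_of_isHomogeneous A D s h₁ hhom
  -- `b = λ̄(a)`
  obtain ⟨x, hx⟩ := hsurj (Over.homMk b hb)
  obtain ⟨a, ha⟩ := A.exists_points_fibrePointToLeft_eq s x
  have hval : A.valueAt s D lam a = b := by
    change A.fibrePointToLeft s a ≫ lam.left = b
    rw [ha]
    exact congrArg CommaMorphism.left hx
  have e : D.pullbackP s b hb = (Scheme.Modules.pullback (A.sliceAt s D lam a)).obj D.P := by
    rw [sliceAt_obj_eq_pullbackP]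
    exact D.pullbackP_congr s hval.symm hb _
  obtain ⟨j⟩ := hΘ a
  -- classes: `[Z] = [𝒫|slice_b] = [t_a^*𝒪(Θ) ⊗ 𝒪(Θ)⁻¹] = [D_a(Θ)]`
  have hM : HasRank (tensorObj
      ((Scheme.Modules.pullback ((A.fibre s).toAbelianVariety.translation a).left).obj (A.lineBundleOfDivisor s Θ))
      (Modules.dual (A.lineBundleOfDivisor s Θ))) 1 :=
    hasRank_tensorObj_one (hasRank_pullback _ Θ.toUnitCocycle.hasRank_lineBundle)
      (hasRank_dual Θ.toUnitCocycle.hasRank_lineBundle)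
  refine ⟨a, ?_⟩
  rw [← CartierDivisor.cechClass_eq_iff_linEquiv,
    ← detClass_eq_cechClass_of_iso (Iso.refl _) (HasRank.isFiniteLocallyFree' h₁),
    ← detClass_translateTensorDual_eq_cechClass_weilDiv (A.fibre s).toAbelianVariety Θ a (HasRank.isFiniteLocallyFree' hM)]
  exact detClass_eq_of_iso (i.symm ≪≫ eqToIso e ≪≫ j) _ _

/-! ## §3 The symmetric ample witness at a point where `λ̄` is onto -/

namespace Polarization

/-- **A SYMMETRIC AMPLE WITNESS AT EVERY GEOMETRIC POINT WHERE `λ̄` IS ONTO**: for a polarisation `λ`, a geometric point `s`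
(`Ω` algebraically closed, `2` invertible in `Ω`) at which every `Ω`-point of `Â` is `x ≫ λ` (`hsurj` — e.g. `λ̄_s` an isogeny),
there is an ample `Θ′` on `A_s` with `λ̄ = Λ(𝒪(Θ′))` at `s` and `(−1)^*Θ′ ∼ Θ′` (§2 feeds the `hF2` of ★
`exists_isAmple_isLambdaOfAt_symmetric_of_forall_exists_linEquiv_weilDiv`). [cite: MumfordAV1970, §8 Thm. 1 (p. 77) and §8 (ii)–(iv) (pp. 74–75)]
[cite: MumfordFogartyKirwan1994, Ch. 6 §2 Definition 6.2–6.3 (p. 120)] -/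
theorem exists_isAmple_isLambdaOfAt_symmetric_of_onto {D : A.DualPair} (pol : A.Polarization D) (h2 : (2 : Ω) ≠ 0)
    (hsurj : ∀ y : D.hat.FibrePoints s, ∃ x : A.FibrePoints s, x ≫ pol.lam = y) :
    ∃ Θ' : CartierDivisor (A.fibre s).toAbelianVariety.X.left, Θ'.IsAmple ∧ A.IsLambdaOfAt s D pol.lam Θ' ∧
      (Θ'.classPullback (((𝟙 (A.fibre s).toAbelianVariety.X)⁻¹ :
        (A.fibre s).toAbelianVariety.X ⟶ (A.fibre s).toAbelianVariety.X)).left).LinEquiv Θ' := by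
  obtain ⟨Θ, hΘ, h⟩ := pol.exists_ample Ω s
  exact pol.exists_isAmple_isLambdaOfAt_symmetric_of_forall_exists_linEquiv_weilDiv A s h2 hΘ h
    fun Z hZ => exists_linEquiv_weilDiv_of_onto A D s pol.lam h hsurj Z hZ

end Polarization

end AbelianSchemeOver

end Literature.AlgebraicGeometry.AbelianSchemes

end
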